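import Summits.AtomisticToContinuum.HydrodynamicLimit.Theorems.KineticFluxLdDecay.Negative.TiltWitnessCalc

/-!

/-!
# Gibbs tilts for `KineticFluxLdDecay` (4/5): `⊥ v`, `⊥ |v|²` and the amplitude clause are load-bearing

Negative knowledge for the crux `AntiMazurCoboundaries.KineticFluxLdDecay` (stmt-AtomisticToContinuum-10967,
shared with `FluxGibbsianityLdDrude`), from the standing disprover's `Cruxes/KineticFluxLdDecay/Disproof.lean`
§ 3. Three variants of the crux — each the statement VERBATIM with one piece of the admissibility clause on
the one-body observable `g` weakened (`KineticFluxLdDecayWith P`) — are FALSE, unconditionally: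

* `kineticFluxLdDecay_false_without_orthVel`: `⊥ v` dropped (`g ⊥ 1, |v|²` only) — witness
  `g = κ' sin v₀`, DRIFT tilt;
* `kineticFluxLdDecay_false_without_orthEnergy`: `⊥ |v|²` dropped (`g ⊥ 1, v` only) — witness
  `g = (κ'/2)(e^{-1/2} − cos v₀)`, TEMPERATURE tilt;
* `kineticFluxLdDecay_false_allAmplitudes`: the amplitude clause `∃ κ, … |g| ≤ κ` replaced by "all bounded
  `g ⊥ span{1, v, |v|²}`" — witness `g = 8 (cos v₁ − cos v₀)`, DRIFT tilt;
* `kineticFluxLdDecay_false_without_phiBound`: the normalisation `|φ| ≤ 1` dropped — `φ ≡ 16/κ'` moves the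
  amplitude into `φ ⊗ g` and the previous witness applies with the admissible `g = (κ'/2)(cos v₁ − cos v₀)`.
Tightness from below: `KineticFluxLdDecayTilt.one_le_lintegral_exp_window` — for every CENTRED `g` the LD
functional is `≥ 1` at every window and every `N` (trivial tilt), so the crux's `δ` cannot be negative.

The common mechanism is `KineticFluxLdDecayTilt.tilt_lower_bound`, a Donsker–Varadhan lower bound with an
INVARIANT tilt: for the reference homogeneous Gibbs law `G_N` (`a = θ = 1`, `u₀ = 0`) and the tilted
homogeneous Gibbs law `Q` (drift `u₁`, temperature `θ₁`), `G_N = Q · e^{∑ᵢ llr1(vᵢ)}` with EQUAL partition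
functions (`localGibbsMeasure_ref_eq_withDensity`), so Jensen under `Q` gives
`(N+1)⁻¹ log ∫⁻ exp(h⁻¹∫₀ʰ ∑ᵢ g(vᵢ(s)) ds) dG_N ≥ E_{N(u₁,θ₁)} g − KL(N(u₁,θ₁) ‖ N(0,1))`
for EVERY window `h` and EVERY `N`: the tilted law is itself flow-invariant
(`Theorems.measurePreserving_flow_localGibbsLaw_const`), so the time average is free
(`integral_windowAvg_regFlowCrux`, Fubini over the jointly measurable regular Alexander flow
`Alexander.regHardSphereFlow`). First-order gains (`κ e^{-1/2} sin t`, `(κ'/2)e^{-1/2}(1 − e^{-s/2})`) beat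
the quadratic entropy costs (`t²/2`, `(3/2)(s − log(1+s))`), and at large amplitude the second-order drift
gain `8 e^{-1/2}(1 − cos 1) ≥ 43/24` beats `1/2`. All Gaussian integrals are exact
(`E cos(t + a wᵢ) = e^{-a²/2} cos t` from `charFun_stdGaussian`). Moral for provers: any proof of the crux
must use ALL THREE orthogonality conditions and the smallness of `κ`; conversely these are the ONLY
profitable homogeneous (flow-invariant Gibbs) tilts, which is why the crux itself resists this attack.
refuter-cdisprove-stmt-AtomisticToContinuum-10967-0.
-/
-/

noncomputable section

open MeasureTheory ProbabilityTheory Real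
open scoped ENNReal InnerProductSpace

namespace Summit.AtomisticToContinuum.HydrodynamicLimit.Theorems

open Literature.MathematicalPhysics.KineticTheory Literature.Analysis.FluidPDE
open Summit.AtomisticToContinuum.HydrodynamicLimit.Theses.AntiMazurCoboundaries (KineticFluxLdDecay)
open KineticFluxLdDecayTilt

/-! ### (N3) `⊥ v` is load-bearing -/

/-- The crux with `⊥ v` DROPPED from the orthogonality clause (`g ⊥ 1, |v|²` only). -/
def KineticFluxLdDecayWithoutOrthVel : Prop :=
  KineticFluxLdDecayWith fun κ g => (∀ v, |g v| ≤ κ) ∧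
    ∀ (c₀ c₂ : ℝ), ∫ v, g v * (c₀ + c₂ * ‖v‖ ^ 2) ∂(stdGaussian V3) = 0

/-- Sanity (contrapositive form): a refutation of the crux would refute the variant. [folklore] -/
theorem not_withoutOrthVel_of_not_crux (hn : ¬ KineticFluxLdDecay) : ¬ KineticFluxLdDecayWithoutOrthVel :=
  fun h => hn <| by
    intro a θ u₀ ha hθ
    obtain ⟨σ₀, hσ₀, H⟩ := h a θ u₀ ha hθ
    refine ⟨σ₀, hσ₀, fun σ hσ hσ' => ?_⟩
    obtain ⟨hA, κ, hκ, hB⟩ := H σ hσ hσ'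
    exact ⟨hA, κ, hκ, fun φ g hφ hg hφ1 hgκ horth =>
      hB φ g hφ hg hφ1 ⟨hgκ, fun c₀ c₂ => by simpa using horth c₀ c₂ 0⟩⟩

/-- **`⊥ v` cannot be dropped**: witness `g = κ' sin v₀` (`κ' = min κ 1`; odd, so `⊥ 1, |v|²`),
DRIFT tilt `u₁ = t e₀`, `t = κ' e^{-1/2}`: gain `κ' e^{-1/2} sin t ≥ (3/4) t²`, cost `t²/2`, so the
per-particle pressure is `≥ t²/4` at EVERY window, uniformly in `N` — against `δ = t²/8`. [folklore] -/
theorem kineticFluxLdDecay_false_without_orthVel : ¬ KineticFluxLdDecayWithoutOrthVel := by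
  intro h
  obtain ⟨σ, hσ, hσ', κ, hκ, H⟩ := h.unpack
  obtain ⟨hc_lo, hc_hi⟩ := exp_neg_half_bounds
  set c : ℝ := Real.exp (-1 / 2) with hc
  set κ' : ℝ := min κ 1 with hκ'
  have hκ'pos : 0 < κ' := lt_min hκ one_pos
  have hκ'le : κ' ≤ κ := min_le_left _ _
  have hκ'1 : κ' ≤ 1 := min_le_right _ _
  set t : ℝ := κ' * c with ht
  have ht0 : 0 < t := mul_pos hκ'pos (by linarith)
  have ht1 : t ≤ 1 := by rw [ht]; nlinarith
  set g : V3 → ℝ := fun v => κ' * Real.sin (v 0) with hg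
  have hgc : Continuous g := continuous_const.mul (Real.continuous_sin.comp (continuous_coord 0))
  have hgK : ∀ v, |g v| ≤ κ' := fun v => by
    rw [hg]; dsimp only; rw [abs_mul, abs_of_pos hκ'pos]
    exact mul_le_of_le_one_right hκ'pos.le (Real.abs_sin_le_one _)
  have hP : (∀ v, |g v| ≤ κ) ∧ ∀ c₀ c₂ : ℝ, ∫ v, g v * (c₀ + c₂ * ‖v‖ ^ 2) ∂stdGaussian V3 = 0 := by
    refine ⟨fun v => (hgK v).trans hκ'le, fun c₀ c₂ => ?_⟩
    exact integral_eq_zero_of_odd_stdGaussian fun v => by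
      simp only [hg, PiLp.neg_apply, Real.sin_neg, norm_neg]; ring
  obtain ⟨hh, hhpos, N, hN⟩ := H g hgc hP (t ^ 2 / 8) (by positivity)
  have hΓ := KineticFluxLdDecayWith.gamma_le one_pos (t • EuclideanSpace.single (0 : Fin 3) (1 : ℝ))
    hgc hgK hhpos hN
  -- evaluate the tilt functional
  have hshift : ∀ w : V3, g (t • EuclideanSpace.single (0 : Fin 3) (1 : ℝ) + Real.sqrt 1 • w) =
      κ' * Real.sin (t + 1 * w 0) := fun w => by
    simp [hg]
  rw [integral_add (integrable_comp_shift_of_abs_le hgc hgK _ _) (integrable_llr1_comp_shift one_pos _),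
    integral_llr1_drift] at hΓ
  simp_rw [hshift] at hΓ
  rw [integral_const_mul, integral_sin_coord, norm_smul, PiLp.norm_single] at hΓ
  simp only [Real.norm_eq_abs, abs_one, mul_one, one_pow, sq_abs] at hΓ
  norm_num at hΓ
  rw [show Real.exp (-(1 / 2) : ℝ) = c by rw [hc]; norm_num] at hΓ
  -- hΓ : κ' * (c * sin t) + -t^2/2 ≤ t^2/8  (up to normalisation)
  have hsin := three_quarters_mul_le_sin ht0.le ht1
  have hkc : κ' * c = t := by rw [ht]
  nlinarith [mul_le_mul_of_nonneg_left hsin ht0.le]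

/-! ### (N4) `⊥ |v|²` is load-bearing -/

/-- The crux with `⊥ |v|²` DROPPED from the orthogonality clause (`g ⊥ 1, v` only). -/
def KineticFluxLdDecayWithoutOrthEnergy : Prop :=
  KineticFluxLdDecayWith fun κ g => (∀ v, |g v| ≤ κ) ∧
    ∀ (c₀ : ℝ) (b : V3), ∫ v, g v * (c₀ + inner ℝ b v) ∂(stdGaussian V3) = 0

/-- Sanity (contrapositive form): a refutation of the crux would refute the variant. [folklore] -/
theorem not_withoutOrthEnergy_of_not_crux (hn : ¬ KineticFluxLdDecay) :
    ¬ KineticFluxLdDecayWithoutOrthEnergy :=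
  fun h => hn <| by
    intro a θ u₀ ha hθ
    obtain ⟨σ₀, hσ₀, H⟩ := h a θ u₀ ha hθ
    refine ⟨σ₀, hσ₀, fun σ hσ hσ' => ?_⟩
    obtain ⟨hA, κ, hκ, hB⟩ := H σ hσ hσ'
    exact ⟨hA, κ, hκ, fun φ g hφ hg hφ1 hgκ horth =>
      hB φ g hφ hg hφ1 ⟨hgκ, fun c₀ b => by simpa using horth c₀ 0 b⟩⟩

/-- **`⊥ |v|²` cannot be dropped**: witness `g = (κ'/2)(e^{-1/2} - cos v₀)` (`κ' = min κ 1`; centred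
because `E cos v₀ = e^{-1/2}`, and `⊥ v` by parity), TEMPERATURE tilt `θ₁ = 1 + s`, `s = κ' e^{-1/2}/24`:
gain `(κ'/2) e^{-1/2} (1 - e^{-s/2}) ≥ κ' e^{-1/2} s/8 = 3 s²`, cost `(3/2)(s - log(1+s)) ≤ (3/2) s²`,
so the per-particle pressure is `≥ (3/2) s²` at every window — against `δ = s²`. [folklore] -/
theorem kineticFluxLdDecay_false_without_orthEnergy : ¬ KineticFluxLdDecayWithoutOrthEnergy := by
  intro h
  obtain ⟨σ, hσ, hσ', κ, hκ, H⟩ := h.unpack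
  obtain ⟨hc_lo, hc_hi⟩ := exp_neg_half_bounds
  set c : ℝ := Real.exp (-1 / 2) with hc
  set κ' : ℝ := min κ 1 with hκ'
  have hκ'pos : 0 < κ' := lt_min hκ one_pos
  have hκ'le : κ' ≤ κ := min_le_left _ _
  have hκ'1 : κ' ≤ 1 := min_le_right _ _
  set s : ℝ := κ' * c / 24 with hs
  have hs0 : 0 < s := by rw [hs]; positivity
  have hs1 : s ≤ 1 := by rw [hs]; nlinarith
  set g : V3 → ℝ := fun v => κ' / 2 * (c - Real.cos (v 0)) with hg
  have hgc : Continuous g :=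
    continuous_const.mul (continuous_const.sub (Real.continuous_cos.comp (continuous_coord 0)))
  have hgK : ∀ v, |g v| ≤ κ' := fun v => by
    rw [hg]; dsimp only; rw [abs_mul, abs_of_pos (by positivity : 0 < κ' / 2)]
    have : |c - Real.cos (v 0)| ≤ 2 := by
      have h1 := Real.abs_cos_le_one (v 0)
      have h2 : |c| ≤ 1 := by rw [abs_of_pos (by linarith)]; exact hc_hi
      calc |c - Real.cos (v 0)| ≤ |c| + |Real.cos (v 0)| := abs_sub _ _
        _ ≤ 2 := by linarith
    nlinarith
  have hcos : ∫ v, Real.cos (v 0) ∂stdGaussian V3 = c := by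
    have h1 : ∀ v : V3, Real.cos (v 0) = Real.cos (0 + 1 * v 0) := fun v => by simp
    simp_rw [h1]
    rw [integral_cos_coord, hc]
    norm_num
  have hP : (∀ v, |g v| ≤ κ) ∧ ∀ (c₀ : ℝ) (b : V3), ∫ v, g v * (c₀ + inner ℝ b v) ∂stdGaussian V3 = 0 := by
    refine ⟨fun v => (hgK v).trans hκ'le, fun c₀ b => ?_⟩
    have hsplit : ∀ v : V3, g v * (c₀ + inner ℝ b v) = c₀ * g v + g v * ⟪b, v⟫_ℝ := fun v => by ring
    simp_rw [hsplit]
    have hi1 : Integrable (fun v => c₀ * g v) (stdGaussian V3) :=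
      (integrable_of_abs_le_stdGaussian hgc hgK).const_mul c₀
    have hi2 : Integrable (fun v => g v * ⟪b, v⟫_ℝ) (stdGaussian V3) :=
      (integrable_inner_stdGaussian b).bdd_mul hgc.aestronglyMeasurable
        (ae_of_all _ fun v => by rw [Real.norm_eq_abs]; exact hgK v)
    rw [integral_add hi1 hi2, integral_const_mul,
      integral_eq_zero_of_odd_stdGaussian (f := fun v : V3 => g v * ⟪b, v⟫_ℝ) fun v => by
        simp only [hg, PiLp.neg_apply, Real.cos_neg, inner_neg_right]; ring]
    have hci : Integrable (fun v : V3 => Real.cos (v 0)) (stdGaussian V3) :=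
      integrable_of_abs_le_stdGaussian (f := fun v : V3 => Real.cos (v 0))
        (Real.continuous_cos.comp (continuous_coord 0)) fun v => Real.abs_cos_le_one _
    have hgint : ∫ v, g v ∂stdGaussian V3 = 0 := by
      simp only [hg]
      rw [integral_const_mul, integral_sub (integrable_const c) hci, integral_const, hcos]
      simp
    rw [hgint]; simp
  obtain ⟨hh, hhpos, N, hN⟩ := H g hgc hP (s ^ 2) (by positivity)
  have hθ₁ : (0 : ℝ) < 1 + s := by positivity
  have hΓ := KineticFluxLdDecayWith.gamma_le hθ₁ (0 : V3) hgc hgK hhpos hN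
  -- evaluate the tilt functional
  have hshift : ∀ w : V3, g ((0 : V3) + Real.sqrt (1 + s) • w) =
      κ' / 2 * (c - Real.cos (0 + Real.sqrt (1 + s) * w 0)) := fun w => by
    simp [hg]
  rw [integral_add (integrable_comp_shift_of_abs_le hgc hgK _ _) (integrable_llr1_comp_shift hθ₁ _),
    integral_llr1_temp hθ₁] at hΓ
  simp_rw [hshift] at hΓ
  have hci : Integrable (fun w : V3 => Real.cos (0 + Real.sqrt (1 + s) * w 0)) (stdGaussian V3) :=
    integrable_of_abs_le_stdGaussian (f := fun w : V3 => Real.cos (0 + Real.sqrt (1 + s) * w 0))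
      (Real.continuous_cos.comp (continuous_const.add (continuous_const.mul (continuous_coord 0))))
      fun v => Real.abs_cos_le_one _
  rw [integral_const_mul, integral_sub (integrable_const c) hci, integral_const, integral_cos_coord,
    Real.sq_sqrt hθ₁.le, Real.cos_zero, mul_one] at hΓ
  simp only [probReal_univ, one_smul, add_sub_cancel_left] at hΓ
  -- hΓ : κ'/2 * (c - exp(-(1+s)/2)) + (3/2 log(1+s) - 3/2 s) ≤ s^2
  have hexp : Real.exp (-(1 + s) / 2) = c * Real.exp (-(s / 2)) := by
    rw [hc, ← Real.exp_add]; congr 1; ring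
  rw [hexp] at hΓ
  have hgain : s / 2 / 2 ≤ 1 - Real.exp (-(s / 2)) :=
    Literature.NumberTheory.LFunctions.PrimeReciprocal.half_le_one_sub_exp_neg (by positivity) (by linarith)
  have hcost := sub_log_one_add_le_sq hs0.le
  have hkc : κ' * c = 24 * s := by rw [hs]; ring
  have hpos1 : 0 ≤ 1 - Real.exp (-(s / 2)) := by linarith [hgain]
  nlinarith [mul_nonneg (mul_nonneg hκ'pos.le (by linarith : (0:ℝ) ≤ c)) hpos1]

/-! ### (N5) The amplitude clause is load-bearing -/

/-- The crux with the amplitude clause DROPPED: all bounded continuous `g ⊥ span{1, v, |v|²}`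
(the amplitude `κ` is then unused). -/
def KineticFluxLdDecayAllAmplitudes : Prop :=
  KineticFluxLdDecayWith fun _ g => (∃ K : ℝ, ∀ v, |g v| ≤ K) ∧ ∀ (c₀ c₂ : ℝ) (b : V3),
    ∫ v, g v * (c₀ + inner ℝ b v + c₂ * ‖v‖ ^ 2) ∂(stdGaussian V3) = 0

/-- Sanity (contrapositive form): a refutation of the crux would refute the variant. [folklore] -/
theorem not_allAmplitudes_of_not_crux (hn : ¬ KineticFluxLdDecay) : ¬ KineticFluxLdDecayAllAmplitudes :=
  fun h => hn <| by
    intro a θ u₀ ha hθ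
    obtain ⟨σ₀, hσ₀, H⟩ := h a θ u₀ ha hθ
    refine ⟨σ₀, hσ₀, fun σ hσ hσ' => ?_⟩
    obtain ⟨hA, κ, hκ, hB⟩ := H σ hσ hσ'
    exact ⟨hA, κ, hκ, fun φ g hφ hg hφ1 hgκ horth => hB φ g hφ hg hφ1 ⟨⟨κ, hgκ⟩, horth⟩⟩

/-- The coordinate swap `v₀ ↔ v₁` as a linear isometry of `ℝ³`. [folklore] -/
def swap01 : V3 ≃ₗᵢ[ℝ] V3 :=
  LinearIsometryEquiv.piLpCongrLeft 2 ℝ ℝ (Equiv.swap (0 : Fin 3) 1)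

/-- The swap exchanges the coordinates `0` and `1`. [folklore] -/
theorem swap01_apply_zero (v : V3) : swap01 v 0 = v 1 := by
  simp [swap01, LinearIsometryEquiv.piLpCongrLeft_apply, Equiv.piCongrLeft'_apply, Equiv.symm_swap,
    Equiv.swap_apply_left]

/-- The swap exchanges the coordinates `1` and `0`. [folklore] -/
theorem swap01_apply_one (v : V3) : swap01 v 1 = v 0 := by
  simp [swap01, LinearIsometryEquiv.piLpCongrLeft_apply, Equiv.piCongrLeft'_apply, Equiv.symm_swap,
    Equiv.swap_apply_right]

/-- **The amplitude clause cannot be replaced by "all bounded `g`"**: witness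
`g = 8 (cos v₁ - cos v₀)` (`⊥ span{1, v, |v|²}` by the swap symmetry `v₀ ↔ v₁` and parity, NO
amplitude restriction), DRIFT tilt `u₁ = e₀`: gain `8 e^{-1/2}(1 - cos 1) ≥ 43/24`, cost `1/2`, so the
per-particle pressure is `≥ 31/24` at every window, uniformly in `N` — against `δ = 1/2`. [folklore] -/
theorem kineticFluxLdDecay_false_allAmplitudes : ¬ KineticFluxLdDecayAllAmplitudes := by
  intro h
  obtain ⟨σ, hσ, hσ', κ, -, H⟩ := h.unpack
  obtain ⟨hc_lo, hc_hi⟩ := exp_neg_half_bounds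
  set c : ℝ := Real.exp (-1 / 2) with hc
  set g : V3 → ℝ := fun v => 8 * (Real.cos (v 1) - Real.cos (v 0)) with hg
  have hgc : Continuous g := continuous_const.mul
    ((Real.continuous_cos.comp (continuous_coord 1)).sub (Real.continuous_cos.comp (continuous_coord 0)))
  have hgK : ∀ v, |g v| ≤ 16 := fun v => by
    rw [hg]; dsimp only; rw [abs_mul]
    have h1 := Real.abs_cos_le_one (v 0)
    have h2 := Real.abs_cos_le_one (v 1)
    have : |Real.cos (v 1) - Real.cos (v 0)| ≤ 2 := by
      calc _ ≤ |Real.cos (v 1)| + |Real.cos (v 0)| := abs_sub _ _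
        _ ≤ 2 := by linarith
    norm_num
    nlinarith
  have hP : (∃ K : ℝ, ∀ v, |g v| ≤ K) ∧ ∀ (c₀ c₂ : ℝ) (b : V3),
      ∫ v, g v * (c₀ + inner ℝ b v + c₂ * ‖v‖ ^ 2) ∂stdGaussian V3 = 0 := by
    refine ⟨⟨16, hgK⟩, fun c₀ c₂ b => ?_⟩
    have hsplit : ∀ v : V3, g v * (c₀ + inner ℝ b v + c₂ * ‖v‖ ^ 2) =
        g v * (c₀ + c₂ * ‖v‖ ^ 2) + g v * ⟪b, v⟫_ℝ := fun v => by ring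
    simp_rw [hsplit]
    have hi1 : Integrable (fun v : V3 => g v * (c₀ + c₂ * ‖v‖ ^ 2)) (stdGaussian V3) :=
      ((integrable_const c₀).add (integrable_norm_sq_stdGaussian.const_mul c₂)).bdd_mul
        hgc.aestronglyMeasurable (ae_of_all _ fun v => by rw [Real.norm_eq_abs]; exact hgK v)
    have hi2 : Integrable (fun v => g v * ⟪b, v⟫_ℝ) (stdGaussian V3) :=
      (integrable_inner_stdGaussian b).bdd_mul hgc.aestronglyMeasurable
        (ae_of_all _ fun v => by rw [Real.norm_eq_abs]; exact hgK v)
    rw [integral_add hi1 hi2,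
      integral_eq_zero_of_odd_stdGaussian (f := fun v : V3 => g v * ⟪b, v⟫_ℝ) fun v => by
        simp only [hg, PiLp.neg_apply, Real.cos_neg, inner_neg_right]; ring]
    -- the even part is antisymmetric under the swap `v₀ ↔ v₁`
    have hanti : ∀ v : V3, g (swap01 v) * (c₀ + c₂ * ‖swap01 v‖ ^ 2) =
        -(g v * (c₀ + c₂ * ‖v‖ ^ 2)) := fun v => by
      rw [LinearIsometryEquiv.norm_map, hg]
      dsimp only
      rw [swap01_apply_zero, swap01_apply_one]
      ring
    have hinv := integral_comp_linearIsometryEquiv_stdGaussian swap01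
      (fun v : V3 => g v * (c₀ + c₂ * ‖v‖ ^ 2))
    simp only [hanti, integral_neg] at hinv
    linarith
  obtain ⟨hh, hhpos, N, hN⟩ := H g hgc hP (1 / 2) (by norm_num)
  have hΓ := KineticFluxLdDecayWith.gamma_le one_pos (EuclideanSpace.single (0 : Fin 3) (1 : ℝ))
    hgc hgK hhpos hN
  have hshift : ∀ w : V3, g (EuclideanSpace.single (0 : Fin 3) (1 : ℝ) + Real.sqrt 1 • w) =
      8 * (Real.cos (0 + 1 * w 1) - Real.cos (1 + 1 * w 0)) := fun w => by
    simp [hg]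
  rw [integral_add (integrable_comp_shift_of_abs_le hgc hgK _ _) (integrable_llr1_comp_shift one_pos _),
    integral_llr1_drift] at hΓ
  simp_rw [hshift] at hΓ
  have hci1 : Integrable (fun w : V3 => Real.cos (0 + 1 * w 1)) (stdGaussian V3) :=
    integrable_of_abs_le_stdGaussian (f := fun w : V3 => Real.cos (0 + 1 * w 1))
      (Real.continuous_cos.comp (continuous_const.add (continuous_const.mul (continuous_coord 1))))
      fun v => Real.abs_cos_le_one _
  have hci0 : Integrable (fun w : V3 => Real.cos (1 + 1 * w 0)) (stdGaussian V3) :=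
    integrable_of_abs_le_stdGaussian (f := fun w : V3 => Real.cos (1 + 1 * w 0))
      (Real.continuous_cos.comp (continuous_const.add (continuous_const.mul (continuous_coord 0))))
      fun v => Real.abs_cos_le_one _
  rw [integral_const_mul, integral_sub hci1 hci0, integral_cos_coord, integral_cos_coord, PiLp.norm_single,
    Real.cos_zero] at hΓ
  simp only [Real.norm_eq_abs, abs_one, one_pow, mul_one] at hΓ
  norm_num at hΓ
  rw [show Real.exp (-(1 / 2) : ℝ) = c by rw [hc]; norm_num] at hΓ
  -- hΓ : 8 * (c - c * cos 1) ≤ 1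
  have hcos := KineticFluxLdDecayTilt.one_sub_cos_one_ge
  nlinarith [mul_le_mul_of_nonneg_left hcos (by linarith : (0:ℝ) ≤ c)]

end Summit.AtomisticToContinuum.HydrodynamicLimit.Theorems
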